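import Mathlib
import Literature.LinearAlgebra.Matrix.BipartiteForestRootCofactor

/-!
# Second-order principal minors of the doubled forest matrix: two distinguished trees

Continuation of `BipartiteForestCofactor` / `BipartiteForestRootCofactor` ([Chaiken1982, §2]: the bipartite
all-minors matrix-forest formula over `𝔽₂`; `N = bigN a D y z ℓ = [[D_y, Pᵀ],[P, D_z]]`,
`det N = setExp (fwt a y z ℓ) D`, `fwt(B) = (Σ_B y) q_z(B) + q_ℓ(B)`).  There the principal cofactors at ONE copy were
identified (mark copy `inl j`: the block of `j` carries `q_z`; root copy `inr j`: the block of `j` carries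
`(Σ y) κ_j`).  Here: the principal minors deleting TWO copies, as the mixed second slopes of `det N` in two of the
variables `y_i`, `y_j`, `z_j` — the `𝔽₂`-shadow of Chaiken's theorem with two distinguished trees:
* `adjugate_updateRow_add_single` — for any matrix, `adj(X with row α += c e_α)_{ββ} = adj(X)_{ββ} +
  c · det (unitize (unitize X α) β)` (`α ≠ β`);
* `det_unitize_unitize_bigN_inl_inl` — deleting the mark copies of `i ≠ j`: the blocks of `i` and `j` are
  DISTINCT and both carry `q_z` (forests with two distinguished `z`-rooted, unmarked trees);
* `det_unitize_unitize_bigN_inl_inr` — deleting the mark copy of `i` and the root copy of `j`: either one block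
  contains both (`κ_j`, the tree through `i` converging to the root `j`) or the block of `i` carries `q_z` and the
  block of `j` carries `(Σ y) κ_j`;
* `sum_sum_mul_det_unitize_unitize_inl_inl`, `sum_sum_mul_det_unitize_unitize_inl_inr` — the weighted sums over
  `(i, j)` as sums over ordered pairs of disjoint blocks (the double borders of Smith's `M₁` in Thm. 2.2 rows 7(a),
  7(b) [Smith2016CongruentDensity, §2.2]).
-/

namespace Literature.LinearAlgebra.Matrix

open _root_.Matrix Finset Literature.Combinatorics.Enumerative

section Adjugate

variable {n : Type*} [Fintype n] [DecidableEq n] {R : Type*} [CommRing R]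

/-- **The diagonal cofactor is affine in another row's diagonal entry**: for `α ≠ β`,
`adj(X.updateRow α (X α + c e_α))_{ββ} = adj(X)_{ββ} + c · det (unitize (unitize X α) β)`.
[cite: HornJohnson2013, §0.8.2 (cofactors; multilinearity of the determinant in the rows)] -/
theorem adjugate_updateRow_add_single (X : Matrix n n R) {α β : n} (hαβ : α ≠ β) (c : R) :
    (X.updateRow α (X α + c • (Pi.single α (1 : R) : n → R))).adjugate β β =
      X.adjugate β β + c * (unitize (unitize X α) β).det := by
  rw [adjugate_apply, adjugate_apply, updateRow_comm _ hαβ, det_updateRow_add, det_updateRow_smul,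
    updateRow_comm X (Ne.symm hαβ) (Pi.single β 1) (Pi.single α 1), ← det_unitize_unitize X hαβ]
  congr 1
  have h : (X.updateRow β (Pi.single β (1 : R))) α = X α := updateRow_ne hαβ
  conv_lhs => rw [← h]
  rw [updateRow_eq_self]

end Adjugate

variable {V : Type*} [Fintype V] [LinearOrder V]

section InlInl

/-- **Deleting two mark copies** (`i ≠ j` in `D`): `det (unitize (unitize N (inl i)) (inl j)) =
Σ_{B₀ ⊆ D∖j, i ∉ B₀} q_z({j} ∪ B₀) · Σ_{B₁ ⊆ (D∖j∖B₀)∖i} q_z({i} ∪ B₁) · setExp(fwt)((D∖j∖B₀)∖i∖B₁)` — forests in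
which `i` and `j` lie in two distinct trees, each `z`-rooted and unmarked (the mixed second slope of `det N` in
`y_i, y_j`). [cite: Chaiken1982, §2 (all minors matrix tree theorem: the minor deleting two vertices of U)] -/
theorem det_unitize_unitize_bigN_inl_inl (a : V → V → ZMod 2) {D : Finset V} {i j : V} (hi : i ∈ D)
    (hj : j ∈ D) (hij : i ≠ j) (y z ℓ : V → ZMod 2) :
    (unitize (unitize (bigN a D y z ℓ) (Sum.inl i)) (Sum.inl j)).det =
      ∑ B₀ ∈ (D.erase j).powerset.filter (fun B₀ => i ∉ B₀), qwt a z (insert j B₀) *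
        ∑ B₁ ∈ (((D.erase j) \ B₀).erase i).powerset, qwt a z (insert i B₁) *
          setExp (fwt a y z ℓ) ((((D.erase j) \ B₀).erase i) \ B₁) := by
  set y' : V → ZMod 2 := Function.update y i (y i + 1) with hy'
  -- determinant side: `det N(y', y_j + 1) = det N(y') + adj(N(y'))_{jj}`, and the cofactor is affine in `y_i`
  have h1 := det_bigN_update_mark a hj y' z ℓ 1
  have hN' : bigN a D y' z ℓ = (bigN a D y z ℓ).updateRow (Sum.inl i)
      ((bigN a D y z ℓ) (Sum.inl i) + (1 : ZMod 2) • (Pi.single (Sum.inl i) (1 : ZMod 2) : V ⊕ V → ZMod 2)) := by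
    rw [hy', bigN_update_mark a hi]
  have h2 : (bigN a D y' z ℓ).adjugate (Sum.inl j) (Sum.inl j) =
      (bigN a D y z ℓ).adjugate (Sum.inl j) (Sum.inl j) +
        (unitize (unitize (bigN a D y z ℓ) (Sum.inl i)) (Sum.inl j)).det := by
    rw [hN', adjugate_updateRow_add_single _ (fun h => hij (Sum.inl_injective h)), one_mul]
  -- forest side
  have h3 := setExp_fwt_update_mark a hj y' z ℓ 1
  have h4 : ∀ B₀ ∈ (D.erase j).powerset, setExp (fwt a y' z ℓ) (D.erase j \ B₀) =
      setExp (fwt a y z ℓ) (D.erase j \ B₀) +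
        (if i ∉ B₀ then ∑ B₁ ∈ (((D.erase j) \ B₀).erase i).powerset, qwt a z (insert i B₁) *
          setExp (fwt a y z ℓ) ((((D.erase j) \ B₀).erase i) \ B₁) else (0 : ZMod 2)) := by
    intro B₀ hB₀
    by_cases hiB : i ∉ B₀
    · have hiT : i ∈ D.erase j \ B₀ := mem_sdiff.mpr ⟨mem_erase.mpr ⟨hij, hi⟩, hiB⟩
      rw [if_pos hiB, hy', setExp_fwt_update_mark a hiT y z ℓ 1, one_mul]
    · rw [if_neg hiB, add_zero]
      refine setExp_congr fun C hC _ => fwt_congr (fun _ _ _ _ _ => rfl) fun m hm => ?_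
      have hmi : m ≠ i := fun h => (mem_sdiff.mp (hC hm)).2 (h ▸ not_not.mp hiB)
      rw [hy', Function.update_of_ne hmi]
  rw [det_bigN_eq_setExp, det_bigN_eq_setExp, h3, one_mul, one_mul, h2, adjugate_bigN_inl_inl a hj,
    sum_congr rfl fun B₀ hB₀ => by rw [h4 B₀ hB₀]] at h1
  simp only [mul_add, sum_add_distrib] at h1
  have h5 := add_left_cancel (add_left_cancel h1)
  rw [← h5, sum_filter]
  refine sum_congr rfl fun B₀ _ => ?_
  split_ifs with h <;> simp

/-- **The double border of two mark-copy vectors** (Chaiken's forests with two distinguished unmarked trees,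
weighted additively): `Σ_{j ∈ D} Σ_{i ∈ D∖j} v_j u_i · det(unitize (unitize N (inl i)) (inl j)) =
Σ_{B ⊆ D} (Σ_B v) q_z(B) · Σ_{B′ ⊆ D∖B} (Σ_{B′} u) q_z(B′) · setExp(fwt)(D∖B∖B′)`.
[cite: Chaiken1982, §2] [cite: Smith2016CongruentDensity, §2.2 (source cnc2.tex l. 36–42: the double border |A+Aᵀ, Aᵀ, u, v; …| = Σ_{S₀ ⊆ S} det O(A,z,u)[S₀] det O(A,z,v)[S − S₀] det M₁[S′])] -/
theorem sum_sum_mul_det_unitize_unitize_inl_inl (a : V → V → ZMod 2) (D : Finset V) (y z ℓ u v : V → ZMod 2) :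
    ∑ j ∈ D, ∑ i ∈ D.erase j, v j * u i * (unitize (unitize (bigN a D y z ℓ) (Sum.inl i)) (Sum.inl j)).det =
      ∑ B ∈ D.powerset, (∑ m ∈ B, v m) * qwt a z B *
        ∑ B' ∈ (D \ B).powerset, (∑ m ∈ B', u m) * qwt a z B' * setExp (fwt a y z ℓ) ((D \ B) \ B') := by
  -- the pointed sum over the block of `i` inside a vertex set `T`
  have hpoint : ∀ T : Finset V,
      ∑ i ∈ T, u i * ∑ B₁ ∈ (T.erase i).powerset, qwt a z (insert i B₁) * setExp (fwt a y z ℓ) ((T.erase i) \ B₁) =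
        ∑ B' ∈ T.powerset, (∑ m ∈ B', u m) * qwt a z B' * setExp (fwt a y z ℓ) (T \ B') := by
    intro T
    have h := sum_sum_powerset_erase_insert T (fun i B' => u i * (qwt a z B' * setExp (fwt a y z ℓ) (T \ B')))
    simp only [mul_sum]
    rw [sum_congr rfl fun i _ => sum_congr rfl fun B₁ _ => by rw [erase_sdiff_eq_sdiff_insert], h]
    refine sum_congr rfl fun B' _ => ?_
    rw [sum_mul, sum_mul]
    exact sum_congr rfl fun m _ => by ring
  -- inner sum over `i`, for fixed `j`: swap `i` and `B₀`
  have hinner : ∀ j ∈ D, ∑ i ∈ D.erase j, v j * u i * (unitize (unitize (bigN a D y z ℓ) (Sum.inl i)) (Sum.inl j)).det =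
      ∑ B₀ ∈ (D.erase j).powerset, v j * (qwt a z (insert j B₀) *
        ∑ B' ∈ (D \ insert j B₀).powerset, (∑ m ∈ B', u m) * qwt a z B' *
          setExp (fwt a y z ℓ) ((D \ insert j B₀) \ B')) := by
    intro j hj
    have hstep : ∀ i ∈ D.erase j, v j * u i * (unitize (unitize (bigN a D y z ℓ) (Sum.inl i)) (Sum.inl j)).det =
        ∑ B₀ ∈ (D.erase j).powerset, if i ∈ (D.erase j) \ B₀ then v j * (qwt a z (insert j B₀) *
          (u i * ∑ B₁ ∈ (((D.erase j) \ B₀).erase i).powerset, qwt a z (insert i B₁) *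
            setExp (fwt a y z ℓ) ((((D.erase j) \ B₀).erase i) \ B₁))) else 0 := by
      intro i hi
      rw [mem_erase] at hi
      rw [det_unitize_unitize_bigN_inl_inl a hi.2 hj hi.1, sum_filter, mul_sum]
      refine sum_congr rfl fun B₀ hB₀ => ?_
      have hiff : i ∈ D.erase j \ B₀ ↔ i ∉ B₀ := by
        rw [mem_sdiff]; exact ⟨fun h => h.2, fun h => ⟨mem_erase.mpr hi, h⟩⟩
      by_cases hiB : i ∉ B₀
      · rw [if_pos hiB, if_pos (hiff.mpr hiB)]; ring
      · rw [if_neg hiB, if_neg (fun h => hiB (hiff.mp h)), mul_zero]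
    rw [sum_congr rfl hstep, sum_comm]
    refine sum_congr rfl fun B₀ _ => ?_
    rw [← sum_filter, filter_mem_eq_inter, inter_eq_right.mpr (sdiff_subset : D.erase j \ B₀ ⊆ D.erase j),
      ← mul_sum, ← mul_sum, hpoint ((D.erase j) \ B₀), erase_sdiff_eq_sdiff_insert]
  rw [sum_congr rfl hinner, sum_sum_powerset_erase_insert D
    (fun j B => v j * (qwt a z B * ∑ B' ∈ (D \ B).powerset, (∑ m ∈ B', u m) * qwt a z B' *
      setExp (fwt a y z ℓ) ((D \ B) \ B')))]
  refine sum_congr rfl fun B _ => ?_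
  rw [sum_mul, sum_mul]
  exact sum_congr rfl fun m _ => by ring

end InlInl

section InlInr

omit [Fintype V] in
/-- Sums of a mark vector raised at `i`: `Σ_S (y + e_i) = Σ_S y + [i ∈ S]`. [cite: Chaiken1982, §2] -/
theorem sum_update_add_one (y : V → ZMod 2) (i : V) (S : Finset V) :
    ∑ m ∈ S, Function.update y i (y i + 1) m = ∑ m ∈ S, y m + if i ∈ S then 1 else 0 := by
  by_cases hi : i ∈ S
  · rw [if_pos hi, ← add_sum_erase S _ hi, ← add_sum_erase S y hi, Function.update_self,
      sum_congr rfl fun m hm => Function.update_of_ne (ne_of_mem_erase hm) _ _]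
    ring
  · rw [if_neg hi, add_zero]
    exact sum_congr rfl fun m hm => Function.update_of_ne (ne_of_mem_of_not_mem hm hi) _ _

/-- **Deleting a mark copy and a root copy** (`i, j ∈ D`, possibly equal):
`det (unitize (unitize N (inl i)) (inr j)) = Σ_{B₀ ⊆ D∖j, i ∈ {j}∪B₀} κ_j({j}∪B₀) · setExp(fwt)(D∖j∖B₀)
 + Σ_{B₀ ⊆ D∖j, i ∉ {j}∪B₀} (Σ_{{j}∪B₀} y) κ_j({j}∪B₀) · Σ_{B₁ ⊆ (D∖j∖B₀)∖i} q_z({i}∪B₁) · setExp(fwt)((D∖j∖B₀)∖i∖B₁)` —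
either one tree contains both `i` and `j` (converging to the unweighted root `j`, its mark at `i`), or the tree of `j`
is rooted at `j` and marked by `y` while the tree of `i` is `z`-rooted and unmarked (the mixed second slope of
`det N` in `y_i, z_j`). [cite: Chaiken1982, §2 (all minors matrix tree theorem: the minor deleting one vertex of U and one of W)] -/
theorem det_unitize_unitize_bigN_inl_inr (a : V → V → ZMod 2) {D : Finset V} {i j : V} (hi : i ∈ D)
    (hj : j ∈ D) (y z ℓ : V → ZMod 2) :
    (unitize (unitize (bigN a D y z ℓ) (Sum.inl i)) (Sum.inr j)).det =
      ∑ B₀ ∈ (D.erase j).powerset.filter (fun B₀ => i ∈ insert j B₀),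
          treeDet a (insert j B₀) j * setExp (fwt a y z ℓ) ((D.erase j) \ B₀) +
        ∑ B₀ ∈ (D.erase j).powerset.filter (fun B₀ => i ∉ insert j B₀),
          (∑ m ∈ insert j B₀, y m) * treeDet a (insert j B₀) j *
            ∑ B₁ ∈ (((D.erase j) \ B₀).erase i).powerset, qwt a z (insert i B₁) *
              setExp (fwt a y z ℓ) ((((D.erase j) \ B₀).erase i) \ B₁) := by
  set y' : V → ZMod 2 := Function.update y i (y i + 1) with hy'
  have hN' : bigN a D y' z ℓ = (bigN a D y z ℓ).updateRow (Sum.inl i)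
      ((bigN a D y z ℓ) (Sum.inl i) + (1 : ZMod 2) • (Pi.single (Sum.inl i) (1 : ZMod 2) : V ⊕ V → ZMod 2)) := by
    rw [hy', bigN_update_mark a hi]
  -- determinant side: the root-copy cofactor is affine in `y_i` with slope the double minor
  have h2 : (bigN a D y' z ℓ).adjugate (Sum.inr j) (Sum.inr j) =
      (bigN a D y z ℓ).adjugate (Sum.inr j) (Sum.inr j) +
        (unitize (unitize (bigN a D y z ℓ) (Sum.inl i)) (Sum.inr j)).det := by
    rw [hN', adjugate_updateRow_add_single _ Sum.inl_ne_inr, one_mul]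
  -- forest side: both the mark sum of the block of `j` and the complementary forest sum move
  have h4 : ∀ B₀ ∈ (D.erase j).powerset, setExp (fwt a y' z ℓ) (D.erase j \ B₀) =
      setExp (fwt a y z ℓ) (D.erase j \ B₀) +
        (if i ∈ D.erase j \ B₀ then ∑ B₁ ∈ (((D.erase j) \ B₀).erase i).powerset, qwt a z (insert i B₁) *
          setExp (fwt a y z ℓ) ((((D.erase j) \ B₀).erase i) \ B₁) else (0 : ZMod 2)) := by
    intro B₀ hB₀
    by_cases hiT : i ∈ D.erase j \ B₀
    · rw [if_pos hiT, hy', setExp_fwt_update_mark a hiT y z ℓ 1, one_mul]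
    · rw [if_neg hiT, add_zero]
      refine setExp_congr fun C hC _ => fwt_congr (fun _ _ _ _ _ => rfl) fun m hm => ?_
      have hmi : m ≠ i := fun h => hiT (h ▸ hC hm)
      rw [hy', Function.update_of_ne hmi]
  have hlhs := adjugate_bigN_inr_inr a hj y' z ℓ
  have hrhs : ∑ B₀ ∈ (D.erase j).powerset, (∑ m ∈ insert j B₀, y' m) * treeDet a (insert j B₀) j *
      setExp (fwt a y' z ℓ) (D.erase j \ B₀) =
      ∑ B₀ ∈ (D.erase j).powerset, (∑ m ∈ insert j B₀, y m + if i ∈ insert j B₀ then 1 else 0) *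
        treeDet a (insert j B₀) j * (setExp (fwt a y z ℓ) (D.erase j \ B₀) +
          if i ∈ D.erase j \ B₀ then ∑ B₁ ∈ (((D.erase j) \ B₀).erase i).powerset, qwt a z (insert i B₁) *
            setExp (fwt a y z ℓ) ((((D.erase j) \ B₀).erase i) \ B₁) else (0 : ZMod 2)) :=
    sum_congr rfl fun B₀ hB₀ => by rw [h4 B₀ hB₀, hy', sum_update_add_one]
  rw [h2, adjugate_bigN_inr_inr a hj y z ℓ, hrhs] at hlhs
  -- `i` lies either in the block of `j` or in its complement
  have hpart : ∀ B₀ ∈ (D.erase j).powerset, (i ∈ insert j B₀ ↔ i ∉ D.erase j \ B₀) := by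
    intro B₀ hB₀
    rw [mem_insert, mem_sdiff, mem_erase]
    constructor
    · rintro (rfl | h)
      · exact fun h => h.1.1 rfl
      · exact fun h' => h'.2 h
    · intro h
      by_cases hij : i = j
      · exact Or.inl hij
      · right; by_contra hiB; exact h ⟨⟨hij, hi⟩, hiB⟩
  have hterm : ∀ B₀ ∈ (D.erase j).powerset,
      (∑ m ∈ insert j B₀, y m + if i ∈ insert j B₀ then 1 else 0) * treeDet a (insert j B₀) j *
          (setExp (fwt a y z ℓ) (D.erase j \ B₀) +
            if i ∈ D.erase j \ B₀ then ∑ B₁ ∈ ((D.erase j \ B₀).erase i).powerset, qwt a z (insert i B₁) *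
              setExp (fwt a y z ℓ) (((D.erase j \ B₀).erase i) \ B₁) else 0) =
        (∑ m ∈ insert j B₀, y m) * treeDet a (insert j B₀) j * setExp (fwt a y z ℓ) (D.erase j \ B₀) +
          ((if i ∈ insert j B₀ then treeDet a (insert j B₀) j * setExp (fwt a y z ℓ) (D.erase j \ B₀) else 0) +
            (if i ∉ insert j B₀ then (∑ m ∈ insert j B₀, y m) * treeDet a (insert j B₀) j *
              ∑ B₁ ∈ ((D.erase j \ B₀).erase i).powerset, qwt a z (insert i B₁) *
                setExp (fwt a y z ℓ) (((D.erase j \ B₀).erase i) \ B₁) else 0)) := by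
    intro B₀ hB₀
    by_cases hiS : i ∈ insert j B₀
    · rw [if_pos hiS, if_neg ((hpart B₀ hB₀).mp hiS), if_pos hiS, if_neg (not_not.mpr hiS)]
      ring
    · rw [if_neg hiS, if_pos (by have := (hpart B₀ hB₀); tauto), if_neg hiS, if_pos hiS]
      ring
  rw [sum_congr rfl hterm, sum_add_distrib, sum_add_distrib] at hlhs
  rw [add_left_cancel hlhs, sum_filter, sum_filter]

/-- **The double border of a mark-copy vector and a root-copy vector**:
`Σ_{j ∈ D} Σ_{i ∈ D} w_j u_i · det(unitize (unitize N (inl i)) (inr j)) =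
Σ_{B ⊆ D} (Σ_B u) q_w(B) · setExp(fwt)(D∖B) + Σ_{B ⊆ D} (Σ_B y) q_w(B) · Σ_{B′ ⊆ D∖B} (Σ_{B′} u) q_z(B′) · setExp(fwt)(D∖B∖B′)`
(one tree rooted by `w` and pointed by `u`, or a `w`-rooted `y`-marked tree and a second `z`-rooted `u`-pointed tree).
[cite: Chaiken1982, §2] [cite: Smith2016CongruentDensity, §2.2 (source cnc2.tex l. 44–52: (eq:7a_develop), the two sums for the borders u and (0; w))] -/
theorem sum_sum_mul_det_unitize_unitize_inl_inr (a : V → V → ZMod 2) (D : Finset V) (y z ℓ u w : V → ZMod 2) :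
    ∑ j ∈ D, ∑ i ∈ D, w j * u i * (unitize (unitize (bigN a D y z ℓ) (Sum.inl i)) (Sum.inr j)).det =
      ∑ B ∈ D.powerset, (∑ m ∈ B, u m) * qwt a w B * setExp (fwt a y z ℓ) (D \ B) +
      ∑ B ∈ D.powerset, (∑ m ∈ B, y m) * qwt a w B *
        ∑ B' ∈ (D \ B).powerset, (∑ m ∈ B', u m) * qwt a z B' * setExp (fwt a y z ℓ) ((D \ B) \ B') := by
  -- the pointed sum over the block of `i` inside a vertex set `T`
  have hpoint : ∀ T : Finset V,
      ∑ i ∈ T, u i * ∑ B₁ ∈ (T.erase i).powerset, qwt a z (insert i B₁) * setExp (fwt a y z ℓ) ((T.erase i) \ B₁) =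
        ∑ B' ∈ T.powerset, (∑ m ∈ B', u m) * qwt a z B' * setExp (fwt a y z ℓ) (T \ B') := by
    intro T
    have h := sum_sum_powerset_erase_insert T (fun i B' => u i * (qwt a z B' * setExp (fwt a y z ℓ) (T \ B')))
    simp only [mul_sum]
    rw [sum_congr rfl fun i _ => sum_congr rfl fun B₁ _ => by rw [erase_sdiff_eq_sdiff_insert], h]
    refine sum_congr rfl fun B' _ => ?_
    rw [sum_mul, sum_mul]
    exact sum_congr rfl fun m _ => by ring
  -- inner sum over `i`, for fixed `j`
  have hinner : ∀ j ∈ D, ∑ i ∈ D, w j * u i * (unitize (unitize (bigN a D y z ℓ) (Sum.inl i)) (Sum.inr j)).det =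
      ∑ B₀ ∈ (D.erase j).powerset, w j * ((∑ m ∈ insert j B₀, u m) * treeDet a (insert j B₀) j *
          setExp (fwt a y z ℓ) (D \ insert j B₀)) +
      ∑ B₀ ∈ (D.erase j).powerset, w j * ((∑ m ∈ insert j B₀, y m) * treeDet a (insert j B₀) j *
        ∑ B' ∈ (D \ insert j B₀).powerset, (∑ m ∈ B', u m) * qwt a z B' *
          setExp (fwt a y z ℓ) ((D \ insert j B₀) \ B')) := by
    intro j hj
    have hstep : ∀ i ∈ D, w j * u i * (unitize (unitize (bigN a D y z ℓ) (Sum.inl i)) (Sum.inr j)).det =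
        ∑ B₀ ∈ (D.erase j).powerset, ((if i ∈ insert j B₀ then w j * (u i * treeDet a (insert j B₀) j *
            setExp (fwt a y z ℓ) ((D.erase j) \ B₀)) else 0) +
          (if i ∈ (D.erase j) \ B₀ then w j * ((∑ m ∈ insert j B₀, y m) * treeDet a (insert j B₀) j *
            (u i * ∑ B₁ ∈ (((D.erase j) \ B₀).erase i).powerset, qwt a z (insert i B₁) *
              setExp (fwt a y z ℓ) ((((D.erase j) \ B₀).erase i) \ B₁))) else 0)) := by
      intro i hi
      rw [det_unitize_unitize_bigN_inl_inr a hi hj, mul_add, sum_filter, sum_filter, mul_sum, mul_sum,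
        ← sum_add_distrib]
      refine sum_congr rfl fun B₀ hB₀ => ?_
      have hiff : i ∈ D.erase j \ B₀ ↔ i ∉ insert j B₀ := by
        rw [mem_sdiff, mem_erase, mem_insert]
        constructor
        · rintro ⟨⟨hij, -⟩, hiB⟩ (h | h)
          · exact hij h
          · exact hiB h
        · intro h
          push Not at h
          exact ⟨⟨h.1, hi⟩, h.2⟩
      congr 1
      · by_cases h : i ∈ insert j B₀
        · rw [if_pos h, if_pos h]; ring
        · rw [if_neg h, if_neg h, mul_zero]
      · by_cases h : i ∈ D.erase j \ B₀
        · rw [if_pos (hiff.mp h), if_pos h]; ring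
        · rw [if_neg (fun h' => h (hiff.mpr h')), if_neg h, mul_zero]
    rw [sum_congr rfl hstep, sum_comm]
    simp only [sum_add_distrib]
    congr 1
    · refine sum_congr rfl fun B₀ hB₀ => ?_
      rw [mem_powerset] at hB₀
      have hsub : insert j B₀ ⊆ D := insert_subset hj (hB₀.trans (erase_subset _ _))
      rw [← sum_filter, filter_mem_eq_inter, inter_eq_right.mpr hsub, erase_sdiff_eq_sdiff_insert, ← mul_sum,
        sum_mul, sum_mul]
    · refine sum_congr rfl fun B₀ _ => ?_
      rw [← sum_filter, filter_mem_eq_inter,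
        inter_eq_right.mpr ((sdiff_subset : D.erase j \ B₀ ⊆ D.erase j).trans (erase_subset j D)),
        ← mul_sum, ← mul_sum, hpoint ((D.erase j) \ B₀), erase_sdiff_eq_sdiff_insert]
  rw [sum_congr rfl hinner, sum_add_distrib,
    sum_sum_powerset_erase_insert D (fun j B => w j * ((∑ m ∈ B, u m) * treeDet a B j * setExp (fwt a y z ℓ) (D \ B))),
    sum_sum_powerset_erase_insert D (fun j B => w j * ((∑ m ∈ B, y m) * treeDet a B j *
      ∑ B' ∈ (D \ B).powerset, (∑ m ∈ B', u m) * qwt a z B' * setExp (fwt a y z ℓ) ((D \ B) \ B')))]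
  congr 1
  · refine sum_congr rfl fun B _ => ?_
    rw [qwt, mul_sum, sum_mul]
    exact sum_congr rfl fun j _ => by ring
  · refine sum_congr rfl fun B _ => ?_
    conv_rhs => rw [qwt, mul_comm (∑ m ∈ B, y m), mul_assoc, sum_mul]
    exact sum_congr rfl fun j _ => by ring

end InlInr

end Literature.LinearAlgebra.Matrix
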